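import Summits.BirchSwinnertonDyer.Rank1Residual.X11b.CharacterSupply
import Literature.NumberTheory.EllipticCurves.DeShalit1987.KatzPAdicLFunctionFunctionalEquation
import Literature.NumberTheory.GaloisRepresentations.HeckeLFunctionEntireContinuationProofs
import Literature.NumberTheory.GaloisRepresentations.CMTypeHeckeCharacter
import HarnessLib

/-!
# Admissible interpolation data on the REFLECTED line `θ_K·‖·‖` from anticyclotomic characters:
# the entire continuation of `L(θ_K‖·‖φ⁻¹, s)` and the typed range conditions
# (brick (f)′ of the [BRω] road R-ψ; helper file 34 for crux 2 `GoodLatticeBDPValue`,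
# stmt-BirchSwinnertonDyer-19032, cell `bsd-eis` seat `bsd-eis-k5-c2`)

The de Shalit frames `DeShalit1987.IsKatzBranch` / `Rubin1991.IsKatzMeasure₂` prescribe values only at
ADMISSIBLE data `(ρ, r, m, j, hL)` and quantify an entire continuation `hL` of `L(λρ, s)`. To USE a
frame (rigidity `isKatzBranch_ext_of_supply`, p490348) one must PRODUCE such data. On the reflected
branch `λ = reflect θ_K⁻¹ = θ_K‖·‖` (weight `−2`) of a `c`-invariant finite-order `θ_K`, the points
are `θ_K‖·‖φ⁻¹` for anticyclotomic `φ` of type `(n, −n)`, `n ≥ 1` (the tree's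
`X11b.characterSupplyAt`), of type `(−(n+1), n−1)` — k5-ty's `DeShalit1987.hasInfinityType_reflect_inv_mul`.
This file supplies the remaining admissibility items:

* `hasEntireContinuation_heckeLFunction_mul_normCharacter` — for `χ` UNITARY and not a norm twist,
  `L(χ‖·‖, s) = L(χ, s+1)` (tree: `heckeLFunction_mul_eq_of_forall_apply_eq_cpow`) is ENTIRE: the
  translate of Tate's entire continuation (tree theorem
  `heckeLFunction_hasEntireContinuation_of_not_isNormTwist_holds`). This is how every weight-`−2`
  de Shalit frame point gets its `hL`.
* `katzBranch_admissible_reflect_inv` — for `θ_K` finite-order, `c`-invariant, unramified off `S`,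
  and an anticyclotomic `φ` (unramified everywhere, UNITARY, type `(n, −n)`, `n ≥ 1`, avatar `e∘ψ`
  through `κ`) with `θ_Kφ⁻¹` not a norm twist: the datum `(φ⁻¹, e∘ψ⁻¹, n+1, n−1)` is admissible for
  `IsKatzBranch … κ γ (reflect θ_K⁻¹) …` — avatar and factorisation of the inverse
  (`isPAdicAvatarOf_inv`, `factorsThroughZp_unitsChar_iff`), range `n−1 < n+1`, infinity type,
  unramified off `S`, and `hL` — together with the evaluation point
  `avatarValueAt (e∘ψ⁻¹) γ = (ψ γ)⁻¹`.

Left to the successor (named, M-sized, no fact): a UNITARY anticyclotomic supply (the tree's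
`characterSupplyAt` does not export unitarity; `lambdaSupplyAt` does) and the non-norm-twist of
`θ_Kφ⁻¹` (infinity type `(−n, n) ≠ (t, t)`). Pure bookkeeping + Tate; no fact, no definition; nothing
about BSD. References: de Shalit 1987 II.4.16 (49)–(50), II.6.1; Tate 1950 Thm. 4.4.1; HOME/k5-c2-MEMO-6.md
§4; HOME/k5-ty-g8/BR-OMEGA-ROAD.md §2 (e)–(f).
-/

-- the summit namespace `Summit.BirchSwinnertonDyer.BirchSwinnertonDyer` repeats the problem name by design (D-0017)
set_option linter.dupNamespace false
set_option autoImplicit false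

noncomputable section

open scoped Classical Topology

open Filter NumberField IsDedekindDomain Field Literature.NumberTheory.EllipticCurves
  Literature.NumberTheory.GaloisRepresentations Literature.NumberTheory.GaloisRepresentations.HeckeCharacter
  Literature.NumberTheory.Automorphic
  Summit.BirchSwinnertonDyer.Rank1Residual.X11b Summit.BirchSwinnertonDyer.Rank1Residual.X11b.Three.LambdaSupply

namespace Summit.BirchSwinnertonDyer.BirchSwinnertonDyer.Theorems.IwasawaTwoVariable

section Shift

variable {K : Type} [Field K] [NumberField K]

/-- **`L(χ‖·‖, s)` is entire for `χ` unitary and not a norm twist**: `L(χ‖·‖, s) = L(χ, s + 1)`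
(`heckeLFunction_mul_eq_of_forall_apply_eq_cpow` with `‖·‖ = ‖·‖^1`), and the translate `s ↦ g(s+1)`
of Tate's entire continuation `g` of `L(χ, ·)` (`heckeLFunction_hasEntireContinuation_of_not_isNormTwist_holds`)
agrees with it on `re s > 1`. (The `hL` of every weight-`−2` point of a de Shalit frame.)
[cite: TateThesis1967, Thm. 4.4.1] [cite: deShalit1987, II.4.16 (50) (store chunk 77)] -/
theorem hasEntireContinuation_heckeLFunction_mul_normCharacter {χ : HeckeCharacter K}
    (hχ : χ.IsUnitary) (hnt : ¬ χ.IsNormTwist) :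
    LFunction.HasEntireContinuation (heckeLFunction (χ * normCharacter K)) := by
  obtain ⟨g, hg, hgL⟩ := heckeLFunction_hasEntireContinuation_of_not_isNormTwist_holds χ hχ hnt
  have hν : ∀ x : ideleGroup K,
      ((normCharacter K x : ℂˣ) : ℂ) = ((ideleNorm x : ℝ) : ℂ) ^ (1 : ℂ) := fun x ↦ by
    rw [Complex.cpow_one, normCharacter_apply]
  refine ⟨fun s ↦ g (s + 1), hg.comp (differentiable_id.add_const 1), fun s hs ↦ ?_⟩
  show g (s + 1) = heckeLFunction (χ * normCharacter K) s
  rw [heckeLFunction_mul_eq_of_forall_apply_eq_cpow χ hν s, hgL (s + 1)]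
  rw [Complex.add_re, Complex.one_re]
  linarith

end Shift

section Admissible

variable {p : ℕ} [Fact p.Prime] {K : Type} [Field K] [NumberField K] [IsCMField K]

omit [NumberField K] [IsCMField K] in
/-- The evaluation point of the inverse character: `(e∘ψ⁻¹)(γ) = (ψ γ)⁻¹` in `ℂ_p`. [folklore] -/
theorem avatarValueAt_unitsChar_inv (ψ : absoluteGaloisGroup K →ₜ* (PadicAlgCl p)ˣ)
    (γ : absoluteGaloisGroup K) :
    avatarValueAt ((FramedRep.unitsContinuousMulEquivOfUnique (Fin 1) (PadicAlgCl p) :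
        (PadicAlgCl p)ˣ →ₜ* GL (Fin 1) (PadicAlgCl p)).comp ψ⁻¹) γ =
      (avatarValueAt ((FramedRep.unitsContinuousMulEquivOfUnique (Fin 1) (PadicAlgCl p) :
        (PadicAlgCl p)ˣ →ₜ* GL (Fin 1) (PadicAlgCl p)).comp ψ) γ)⁻¹ := by
  have h1 : avatarValueAt ((FramedRep.unitsContinuousMulEquivOfUnique (Fin 1) (PadicAlgCl p) :
        (PadicAlgCl p)ˣ →ₜ* GL (Fin 1) (PadicAlgCl p)).comp ψ⁻¹) γ *
      avatarValueAt ((FramedRep.unitsContinuousMulEquivOfUnique (Fin 1) (PadicAlgCl p) :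
        (PadicAlgCl p)ˣ →ₜ* GL (Fin 1) (PadicAlgCl p)).comp ψ) γ = 1 := by
    rw [avatarValueAt_unitsChar, avatarValueAt_unitsChar, unitsChar_inv_apply,
      ← UniformSpace.Completion.coe_mul, ← Units.val_mul, inv_mul_cancel, Units.val_one,
      UniformSpace.Completion.coe_one]
  exact eq_inv_of_mul_eq_one_left h1

/-- **Admissible datum on the reflected line from an anticyclotomic character.** `θ_K` finite-order,
`c`-invariant (`θ_K ∘ c = θ_K`), unramified at every `w ∉ S`; `φ` unramified everywhere, unitary, of
type `(n, −n)` with `n ≥ 1`, with rank-one avatar `e∘ψ` factoring through `κ`; `θ_Kφ⁻¹` not a norm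
twist. Then for the branch `λ = reflect θ_K⁻¹ = θ_K‖·‖`: `e∘ψ⁻¹` is the avatar of `φ⁻¹` and factors
through `κ`; `n − 1 < n + 1`; `λφ⁻¹` has type `(−(n+1), n−1)`; `λφ⁻¹` is unramified at every `w ∉ S`;
and `L(λφ⁻¹, s)` is entire — i.e. `(φ⁻¹, e∘ψ⁻¹, n+1, n−1, hL)` is an admissible datum of
`DeShalit1987.IsKatzBranch ι v v̄ S κ γ (reflect θ_K⁻¹) Ω δ Ω_p` (any `v̄, γ, Ω, δ, Ω_p`).
[cite: deShalit1987, II.4.16 (49)–(50) (store chunk 76–77), II.6.1 (1) (store chunk 81)]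
[cite: TateThesis1967, Thm. 4.4.1] -/
theorem katzBranch_admissible_reflect_inv (ι : PadicAlgCl p ≃+* ℂ) {θK : HeckeCharacter K}
    (hfin : θK.IsFiniteOrder) (hgal : HeckeCharacter.galConj (IsCMField.complexConj K) θK = θK)
    {S : Finset (HeightOneSpectrum (𝓞 K))}
    (hunrθ : ∀ w : HeightOneSpectrum (𝓞 K), w ∉ S → θK.IsUnramifiedAt w)
    {κ : ZpExtension K p} {φ : HeckeCharacter K} {ψ : absoluteGaloisGroup K →ₜ* (PadicAlgCl p)ˣ}
    {n : ℕ} (hn : 1 ≤ n) (hφunr : ∀ w : HeightOneSpectrum (𝓞 K), φ.IsUnramifiedAt w)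
    (hφu : φ.IsUnitary) (hφinf : φ.HasInfinityType (fun _ ↦ (n : ℤ)) (fun _ ↦ -(n : ℤ)))
    (hφav : IsPAdicAvatarOf ι φ ((FramedRep.unitsContinuousMulEquivOfUnique (Fin 1) (PadicAlgCl p) :
        (PadicAlgCl p)ˣ →ₜ* GL (Fin 1) (PadicAlgCl p)).comp ψ))
    (hφκ : FactorsThroughZp κ ((FramedRep.unitsContinuousMulEquivOfUnique (Fin 1) (PadicAlgCl p) :
        (PadicAlgCl p)ˣ →ₜ* GL (Fin 1) (PadicAlgCl p)).comp ψ))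
    (hnt : ¬ (θK * φ⁻¹).IsNormTwist) :
    IsPAdicAvatarOf ι φ⁻¹ ((FramedRep.unitsContinuousMulEquivOfUnique (Fin 1) (PadicAlgCl p) :
        (PadicAlgCl p)ˣ →ₜ* GL (Fin 1) (PadicAlgCl p)).comp ψ⁻¹) ∧
      FactorsThroughZp κ ((FramedRep.unitsContinuousMulEquivOfUnique (Fin 1) (PadicAlgCl p) :
        (PadicAlgCl p)ˣ →ₜ* GL (Fin 1) (PadicAlgCl p)).comp ψ⁻¹) ∧
      (n - 1 < n + 1) ∧
      (DeShalit1987.reflect θK⁻¹ * φ⁻¹).HasInfinityType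
        (fun _ ↦ -((n + 1 : ℕ) : ℤ)) (fun _ ↦ ((n - 1 : ℕ) : ℤ)) ∧
      (∀ w : HeightOneSpectrum (𝓞 K), w ∉ S → (DeShalit1987.reflect θK⁻¹ * φ⁻¹).IsUnramifiedAt w) ∧
      LFunction.HasEntireContinuation (heckeLFunction (DeShalit1987.reflect θK⁻¹ * φ⁻¹)) := by
  have hrefl : DeShalit1987.reflect θK⁻¹ = θK * normCharacter K :=
    DeShalit1987.reflect_inv_of_galConj_eq hgal
  refine ⟨isPAdicAvatarOf_inv ι hφav, ?_, by omega, ?_, ?_, ?_⟩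
  · -- factorisation through `κ` of the inverse
    rw [factorsThroughZp_unitsChar_iff] at hφκ ⊢
    intro σ hσ
    rw [unitsChar_inv_apply, hφκ σ hσ, inv_one]
  · -- infinity type `(−(n+1), n−1)`
    refine DeShalit1987.hasInfinityType_reflect_inv_mul (hasInfinityType_zero_of_isFiniteOrder hfin)
      hn ?_
    convert hφinf.inv using 2 <;> simp
  · -- unramified off `S`
    intro w hw
    rw [hrefl]
    exact ((hunrθ w hw).mul' (isUnramifiedAt_normCharacter' w)).mul' (hφunr w).inv'
  · -- entire continuation: `θ_K‖·‖φ⁻¹ = (θ_Kφ⁻¹)‖·‖`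
    have heq : DeShalit1987.reflect θK⁻¹ * φ⁻¹ = (θK * φ⁻¹) * normCharacter K := by
      rw [hrefl, mul_right_comm]
    rw [heq]
    exact hasEntireContinuation_heckeLFunction_mul_normCharacter
      ((IsFiniteOrder.isUnitary hfin).mul hφu.inv) hnt

end Admissible

end Summit.BirchSwinnertonDyer.BirchSwinnertonDyer.Theorems.IwasawaTwoVariable

end
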